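import Mathlib
import Literature.MathematicalPhysics.QuantumFieldTheory.Luscher2010.TrivializingMaps
import Literature.MathematicalPhysics.QuantumFieldTheory.Luscher2010.FlowActionSeries
import HarnessLib

/-!
# Lüscher's volume-uniform convergence question — a venture conjecture item (never Literature), PROVED in the tree 2026-08-21

HONEST FRAMING: exact (Metropolis-corrected) sampling algorithms for lattice gauge theory; figures
of merit are autocorrelation/cost numbers at stated couplings and volumes; no continuum-physics claim.

Proposed tree file: `Summits/Ventures/LatticeQCDFlow/TrivializingMaps/UniformRadius.lean`.

Lüscher, CMP 293 (2010) 899, §4.5(b), verbatim: "The norm estimates in appendix E imply a lower bound on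
the convergence radius of the series, but this bound is rather poor and vanishes in the infinite-volume
limit. It seems nevertheless plausible that the series has a non-zero convergence radius in this limit,
because the inverse of the operator L in eq. (4.10) is likely to remain bounded in a complex neighbourhood
of t = 0. An analysis that takes the locality properties of L into account will however be required to
show this."  This is an OPEN QUESTION stated by the author; by the placement rule it is typed here as a
`@[conjecture]` obligation of the venture, for the one-parameter family of Wilson actions
`S = β · S_W` on the lattices `(ℤ/Lℤ)^d`, `L ≥ 1`, with the radius depending on `(d, n, β)` but NOT on `L`.
STATUS (2026-08-21): PROVED ON PAPER for every compact gauge group and every `(d, n, β)` — THEORY-1.md §12,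
THEOREM A (pub-lqcd theory-1 seat, 2026-08-21; second-seat review PASS, HOME/tribunal/R-T1-11-review-theory2.md):
an explicit `L`-independent radius `|t|·|β| < 1/θ₀(d,n)`.  The `U(1)` analogue is KERNEL-CHECKED
(`TrivializingMaps/AbelianRadius.lean` … `AbelianDictionary.lean`).  FORMAL PROOF OF THIS decl LANDED
2026-08-21 (the words "open" above are historical): `luscherUniformRadius_holds (d n : ℕ) (β : ℝ) :
LuscherUniformRadius d n β` in `TrivializingMaps/TheoremA.lean` (p287885), from THEOREM A
`GradedSeries.luscherGeometricGradientBound_holds` (`TrivializingMaps/GradedTheoremA.lean`, p287466) via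
`luscherUniformRadius_of_geometric` (`TrivializingMaps/UniformRadiusAllBeta.lean`); the decl keeps the audit class
`@[conjecture]` as the item's node (cell ruling, FANOUT Amendment 15(e)), its discharge is the `_holds` theorem.
What converges: the link gradients `∂^a_{x,μ} S̃^{(k)}` of the Lüscher series — the generator
`Z_t = -∂S̃_t` that a trivializing-flow HMC actually integrates (§6.3).
-/

namespace Summit.Ventures.LatticeQCDFlow.TrivializingMaps

open Literature.MathematicalPhysics.QuantumFieldTheory
open Literature.MathematicalPhysics.QuantumFieldTheory.Luscher2010
open scoped Matrix Matrix.Norms.Frobenius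

/-- Local notation for `SU(n) ⊆ M_n(ℂ)`, as in `WilsonFlow.lean`. -/
local notation "SU[" n "]" => Matrix.specialUnitaryGroup (Fin n) ℂ

noncomputable section

/-- The Wilson plaquette action in Lüscher's normalisation, on AMBIENT configurations (so that link
derivatives make sense): `S_W(W) = ∑_{x} ∑_{μ<ν} Re tr(1 - W_p)` with
`W_p = W(x,μ) W(x+μ̂,ν) W(x+ν̂,μ)ᴴ W(x,ν)ᴴ`; on `SU(n)^E` it is Wave 0's `wilsonAction` in the defining
representation. [cite: Luscher2010Trivializing, §4.4 eq. (4.16) (there `S = -(β/6) W₀` for SU(3))] -/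
def ambWilsonAction {d L n : ℕ} [NeZero L] (W : AmbConfig d L n) : ℝ :=
  ∑ x : Site d L, ∑ μ : Fin d, ∑ ν : Fin d,
    if μ < ν then ((1 : Matrix (Fin n) (Fin n) ℂ) -
      W (x, μ) * W (x.shift μ, ν) * (W (x.shift ν, μ))ᴴ * (W (x, ν))ᴴ).trace.re else 0

/-- **Conjecture (Lüscher 2010, §4.5(b)) — volume-uniform radius of convergence of the trivializing-flow
expansion for the Wilson action.** For every dimension `d`, gauge group `SU(n)` and coupling `β` there is
`r > 0`, INDEPENDENT OF THE LATTICE SIZE `L`, such that for every `L ≥ 1`, every orthonormal basis of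
`𝔰𝔲(n)`, and every smooth Lüscher series `(S̃^{(k)})_k` of `S = β S_W` (recursion (4.14)–(4.15)), the
gradient series `∑_k t^k ∂^a_{x,μ} S̃^{(k)}(U)` converges absolutely for `|t| < r`, at every link, colour
index and field `U ∈ SU(n)^E`. Lüscher proves `r = r(L) > 0` for each fixed `L` (App. E) with
`r(L) → 0` as `L → ∞`; the uniform statement is the open question quoted in the module docstring.
STATUS: PROVED for all `(d, n, β)` — on paper THEORY-1 §12 Theorem A (2026-08-21, second-seat reviewed — PASS),
formally `luscherUniformRadius_holds` (`TrivializingMaps/TheoremA.lean`, p287885, from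
`GradedSeries.luscherGeometricGradientBound_holds`, `TrivializingMaps/GradedTheoremA.lean`, p287466);
`U(1)` analogue kernel-checked in `TrivializingMaps/Abelian*.lean`.
[cite: Luscher2010Trivializing, §4.5(b)] -/
@[conjecture]
def LuscherUniformRadius (d n : ℕ) (β : ℝ) : Prop :=
  ∃ r : ℝ, 0 < r ∧ ∀ (L : ℕ) [NeZero L] (B : SuBasis n) (Sk : ℕ → AmbConfig d L n → ℝ) (c : ℕ → ℝ),
    (∀ k, ContDiff ℝ (⊤ : ℕ∞) (Sk k)) →
    IsLuscherSeries B (fun W => β * ambWilsonAction W) Sk c →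
    ∀ (t : ℝ), |t| < r → ∀ (U : GaugeConfig d L SU[n]) (e : Edge d L) (a : B.ι),
      Summable fun k => |t| ^ k * |linkDeriv e (B.T a) (Sk k) (WilsonFlow.coeConfig U)|

end

end Summit.Ventures.LatticeQCDFlow.TrivializingMaps
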